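import Literature.NumberTheory.EllipticCurves.BSDHeegnerPoints
import Literature.NumberTheory.EllipticCurves.Tamagawa
import Mathlib.NumberTheory.NumberField.ClassNumber
import HarnessLib

/-!
# Kriz–Li 2019, Theorem 1.23 (= Theorem 10.10): the `3`-part of the BSD formula over `K` for the sextic twists `E_d : y² = x³ − 432d`

HONEST FRAMING (cell `b2b-bsdres`, run/shared/lean/b2b/bsd-rank1-residual/; page 1 everywhere):
prove what is provable now; shrink each hard class to its core with data; no claim beyond stated
classes. The cell deletes the COMBINATION-SHAPED residual classes of the BSD formula in analytic
rank `≤ 1` from PUBLISHED theorems only and TYPES the construction-shaped ones; this is not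
"finishing BSD". This file vendors ONE published theorem as a named fact (`def … : Prop`, nothing
asserted; D-0014), in the tree's Heegner-point vocabulary of
`Literature/NumberTheory/EllipticCurves/HeegnerPoints.lean` / `BSDHeegnerPoints.lean`
(`ModularParametrizationData`, its Manin constant `Dt.c`, `HeegnerDatum`, `heegnerPointComplex`,
`IsImaginaryQuadratic`, `SatisfiesHeegnerHypothesis`, `analyticRankEK`) and of `Tamagawa.lean`,
`Sha.lean`, `MordellWeil.lean` (`tamagawaProduct`, `shaOrder`, `mordellWeilRank`). It is the
printed input of the harvest seat's proposal `HOME/b2b-bsdres-harvest-2/KL19-X12-SEXTIC.md`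
(residual class X12 of RESIDUAL-CASES §a.2 — CM, rank `1`, `p = 3` ramified in the CM field — has a
published combination route on the sub-population of sextic twists: this theorem + Gross–Zagier
1986 V.(2.2) + Milne 1972 / Cassels + Burungale–Flach 2024 Cor. 2). No consumer towards
`BSD(E,3)` over `ℚ` is proved here: that needs the RANK-ONE quadratic descent of the BSD quotient
(Milne 1972, printed; the tree's `BSDQuadraticDescent.lean` has the rank-zero shape only).

## Citation header (read by this seat)

* Authors: Daniel Kriz, Chao Li.
* Title: *Goldfeld's conjecture and congruences between Heegner points*.
* Venue: Forum of Mathematics, Sigma **7** (2019), e15, 80 pp., doi:10.1017/fms.2019.9 (open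
  access; bib key `KrizLi2019`). REFEREED / PUBLISHED. The journal paper merges arXiv:1606.03172v3
  and arXiv:1609.06687v3 (*Heegner points at Eisenstein primes and twists of elliptic curves*); the
  theorem below is Theorem 1.23 of the journal text ("THEOREM 1.23 (Theorem 10.10)", store
  `paper:doi-10-1017-fms-2019-9` p. 3) = `\label{thm:bsdmain}` (intro, ll. 380–389) and
  `\label{thm:BSD3}` (§"The 3-part of the BSD conjecture over `K`", ll. 1463–1465) of the authors'
  LaTeX source `Eisenstein.tex` of arXiv:1609.06687v3, with Theorem `\label{thm:sextic}`
  (ll. 1407–1420) and Corollary `mod9corollary` (ll. 1427–1433) = journal Thm. 10.6 / Cor. 10.7.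
* Verbatim (TeX ll. 378–389):

> We establish the following new results on BSD(3) for many sextic twists
> `E_d : y² = x³ − 432d`, in the case `p = 3` is *additive* and *Eisenstein*.
> **Theorem 1.23 (Theorem 10.10).** Suppose `K` is an imaginary quadratic field satisfies the
> Heegner hypothesis for `3d`. Assume that
> (1) `d` is a fundamental discriminant.
> (2) `d ≡ 2, 3, 5, 8 (mod 9)`.
> (3) If `d > 0`, `h₃(−3d) = h₃(d_K d) = 1`. If `d < 0`, `h₃(d) = h₃(−3 d_K d) = 1`.
> (4) The Manin constant of `E_d` is coprime to `3`.
> Then `r_an(E_d/K) = 1` and BSD(3) holds for `E_d/K`. (Here `h₃(D)` denotes the `3`-class number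
> of `ℚ(√D)`.)

  and (§10.3, TeX ll. 1467–1478): "By the Gross–Zagier formula, the BSD conjecture for `E_d/K` is
  equivalent to the equality ([GZ86, V.2.2])
  `u_K · c_{E_d} · ∏_{ℓ ∣ N(E_d)} c_ℓ(E_d) · |Ш(E_d/K)|^{1/2} = [E_d(K) : ℤ P_d]`, where
  `u_K = |𝒪_K^×/{±1}|`, `c_{E_d}` is the Manin constant of `E_d/ℚ`, `c_ℓ(E_d) = [E_d(ℚ_ℓ) : E_d⁰(ℚ_ℓ)]`
  is the local Tamagawa number of `E_d` and `[E_d(K) : ℤ P_d]` is the index of the Heegner point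
  `P_d ∈ E_d(K)`. … Since `3` splits in `K` … `u_K = 1`. Therefore the BSD conjecture for `E_d/K` is
  equivalent to the equality `∏_{ℓ ∣ N(E_d)} c_ℓ(E_d) · |Ш(E_d/K)|^{1/2} = [E_d(K) : ℤ P_d]/c_{E_d}`.
  We will prove BSD(3) by computing the `3`-part of both sides … explicitly."; Theorem 10.6
  (`thm:sextic`, hypotheses (1), (2′) `d ≡ 2 (mod 3)` or `d ≡ 3 (mod 9)`, (3)): "`log_{ω_{E_d}} P_d
  ≢ 0 (mod 3)`. In particular, `P_d` is of infinite order and `E_d/K` has both analytic and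
  algebraic rank one." (`P_d ∈ E_d(K)` the Heegner point of the fixed modular parametrisation
  `π_{E_d} : X₀(N) → E_d`, journal p. 2: "defined up to sign and torsion with respect to a fixed
  modular parametrization"; `c_{E_d}` its Manin constant.)

## Hypotheses, enumerated (word for word → tree vocabulary)

1. `E_d : y² = x³ − 432d` — `W : WeierstrassCurve ℚ`, elliptic and globally minimal (the tree's
   `tamagawaProduct`, `conductorNorm` are read on a globally minimal model), `ℚ`-isomorphic to the
   displayed model: `∃ C : VariableChange ℚ, C • W = ⟨0, 0, 0, 0, −432 d⟩` (the displayed model is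
   in general not minimal at `2`, e.g. `d = 5`: `225a2`). CM by `ℤ[ζ₃]` (`j = 0`), `3` ADDITIVE
   ("`E_d` has additive reduction exactly at the prime factors of `3d`", l. 1401) and EISENSTEIN
   (`E_d[3]^{ss} = 𝔽₃(ψ_d) ⊕ 𝔽₃(ψ_d ω)`, Lemma `lem:mod3rep`) — consequences, not hypotheses.
2. "`K` is an imaginary quadratic field [satisfying] the Heegner hypothesis for `3d`" —
   `IsImaginaryQuadratic K`, `SatisfiesHeegnerHypothesis (3 * d.natAbs) K` (every prime of `3d`
   splits in `K`; the prime support of `N(E_d)` is that of `3d`). The Heegner point: a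
   parametrisation datum `Dt : ModularParametrizationData W N` at level `N = N(E_d)`
   (`W.conductorNorm ℤ = N`), a Heegner datum `H : HeegnerDatum N d_K`, an embedding `ι : K → ℂ` and
   `P ∈ E_d(K)` with `ι(P) = ∑_{[Q]} φ(τ_Q)` (`heegnerPointComplex Dt H`) — literally the binder
   pattern of the tree's `grossZagierFormula_iff`; `c_{E_d}` = `Dt.c` (the Manin constant OF THE
   SAME parametrisation, as in the print).
3. (1) "`d` is a fundamental discriminant" — spelled as in
   `QuadraticFields/FundamentalDiscriminant.lean` (`d ≡ 1 (mod 4)` squarefree `≠ 1`, or `d = 4m`,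
   `m ≡ 2, 3 (mod 4)` squarefree; literally the body of
   `Literature.Barriers.RiemannHypothesis.IsFundamentalDiscriminant`, not imported).
4. (2) "`d ≡ 2, 3, 5, 8 (mod 9)`" — `d % 9 ∈ {2, 3, 5, 8}` (`Int.emod`, non-negative remainder).
5. (3) "`h₃(D) = 1`", the `3`-class number of the FIELD `ℚ(√D)` — `ThreeClassNumberTrivial D`:
   every quadratic number field in which `D` is a square (all such fields are isomorphic to `ℚ(√D)`)
   has class number prime to `3` (Mathlib `NumberField.classNumber`).
6. (4) "The Manin constant of `E_d` is coprime to `3`" — `¬ 3 ∣ Dt.c`.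
7. Conclusion "`r_an(E_d/K) = 1`" — `analyticRankEK W K = 1` (`ord_{s=1} L(E_d,s) L(E_d^{(d_K)},s)`);
   Thm. 10.6's "`P_d` of infinite order … algebraic rank one" — `¬ IsOfFinAddOrder P`,
   `(W.baseChange K).mordellWeilRank = 1` (Theorem 10.10 is stated "in the situation of Theorem
   10.6", whose conclusion we record); "BSD(3) holds for `E_d/K`" = the `3`-adic valuations of the
   two sides of the last display agree, squared to stay in `ℕ`:
   `2·ord₃(∏_ℓ c_ℓ(E_d)) + ord₃ #Ш(E_d/K) = 2·ord₃ [E_d(K) : ℤ P_d]` (the term `2·ord₃ c_{E_d}`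
   vanishes by (4)); `#Ш(E_d/K)` = `(W.baseChange K).shaOrder` under the binder
   `Finite (W.baseChange K).sha` (a theorem here — rank one, Kolyvagin — carried as a binder exactly
   as in the sibling facts `CastellaGrossiSkinner2025.thmD_…`, `BurungaleCastellaSkinner2025.cor131_…`;
   weaker, never stronger).

No `_holds` is to be expected (p-adic logarithms of Heegner points at Eisenstein primes,
Coleman integration, explicit `3`-descent over `K`: none in Mathlib). D-0026: exactly ONE new named
fact; the auxiliary `ThreeClassNumberTrivial` is a predicate with an argument (a definition with a
body), not a fact. Registry: HOME/CITED-FACTS.md (harvest seat `b2b-bsdres-harvest-2`, gen 2).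

## References
* [KrizLi2019] D. Kriz, C. Li, *Goldfeld's conjecture and congruences between Heegner points*,
  Forum Math. Sigma 7 (2019) e15, Thm. 1.23 = Thm. 10.10, Thm. 10.6, Cor. 10.7; = arXiv:1609.06687v3
  (`thm:bsdmain`, `thm:BSD3`, `thm:sextic`, `mod9corollary`).
* B. H. Gross, D. Zagier, *Heegner points and derivatives of `L`-series*, Invent. Math. 84 (1986),
  V.(2.2) (the index form of BSD over `K`); tree `BSDHeegnerPoints.lean`.
* J. E. Cremona, appendix to A. Agashe, K. Ribet, W. Stein, *The Manin constant*, PAMQ 2 (2006)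
  617–636, Thm. 2.6 (hypothesis (4) per curve).
* HOME/b2b-bsdres-harvest-2/KL19-X12-SEXTIC.md (the combination route and the census reach).
-/

noncomputable section

open scoped Classical

open WeierstrassCurve NumberField Literature.NumberTheory.EllipticCurves
  Literature.NumberTheory.EllipticCurves.ModularForms

namespace Literature.NumberTheory.EllipticCurves.KrizLi2019

/-- "`h₃(D) = 1`": the `3`-class number of the quadratic field `ℚ(√D)` is trivial, i.e. `3` does
not divide the class number of any quadratic number field in which `D` is a square (for `D` not a
rational square these fields are exactly the copies of `ℚ(√D)`; Kriz–Li: "`h₃(D)` denotes the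
`3`-class number of `ℚ(√D)`"). A predicate on `D`, not a named fact. [cite: KrizLi2019, Thm. 1.23 (notation)] -/
def ThreeClassNumberTrivial (D : ℤ) : Prop :=
  ∀ (F : Type) [Field F] [NumberField F],
    Module.finrank ℚ F = 2 → (∃ x : F, x ^ 2 = (D : F)) → ¬ 3 ∣ NumberField.classNumber F

/-- Unfolding of `ThreeClassNumberTrivial`. [folklore] -/
theorem threeClassNumberTrivial_iff (D : ℤ) :
    ThreeClassNumberTrivial D ↔
      ∀ (F : Type) [Field F] [NumberField F],
        Module.finrank ℚ F = 2 → (∃ x : F, x ^ 2 = (D : F)) → ¬ 3 ∣ NumberField.classNumber F :=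
  Iff.rfl

/-- **Kriz–Li, Forum Math. Sigma 7 (2019) e15, Theorem 1.23 (= Theorem 10.10), with Theorem 10.6
and §10.3** (= arXiv:1609.06687v3 `thm:bsdmain` / `thm:BSD3` / `thm:sextic`): "Suppose `K` is an
imaginary quadratic field [satisfying] the Heegner hypothesis for `3d`. Assume that (1) `d` is a
fundamental discriminant. (2) `d ≡ 2,3,5,8 (mod 9)`. (3) If `d > 0`, `h₃(−3d) = h₃(d_K d) = 1`. If
`d < 0`, `h₃(d) = h₃(−3d_K d) = 1`. (4) The Manin constant of `E_d` is coprime to `3`. Then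
`r_an(E_d/K) = 1` and BSD(3) holds for `E_d/K`", for the sextic twist `E_d : y² = x³ − 432d`
(`p = 3` additive and Eisenstein, CM `j = 0`), where "BSD(3) for `E_d/K`" is (§10.3) the `3`-part of
Gross's index identity `∏_{ℓ ∣ N(E_d)} c_ℓ(E_d) · |Ш(E_d/K)|^{1/2} = [E_d(K) : ℤP_d]/c_{E_d}`
(`u_K = 1` as `3` splits in `K`), `P_d ∈ E_d(K)` the Heegner point of a fixed modular
parametrisation and `c_{E_d}` ITS Manin constant; Theorem 10.6: `P_d` has infinite order and
`E_d/K` has analytic and algebraic rank one. Tree rendering (module docstring items 1–7): `W` a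
globally minimal model `ℚ`-isomorphic to `y² = x³ − 432d`, `N = N(E_d)`, `Dt` a parametrisation
datum at level `N` with Manin constant `Dt.c`, `P` a point of `E_d(K)` mapping to the Heegner point
`heegnerPointComplex Dt H` under `ι : K → ℂ`; conclusion: `P` of infinite order,
`analyticRankEK W K = 1`, `rank E_d(K) = 1`, and — under the binder `Finite Ш(E_d/K)` —
`2·ord₃ ∏_ℓ c_ℓ(E_d) + ord₃ #Ш(E_d/K) = 2·ord₃ [E_d(K) : ℤP]` (the `c_{E_d}`-term vanishing by (4)).
PUBLISHED. [cite: KrizLi2019, Thm. 1.23 = Thm. 10.10 (with Thm. 10.6, §10.3 display)] -/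
def thm1010_bsdThree_overK_sexticTwist : Prop :=
  ∀ (d : ℤ) (W : WeierstrassCurve ℚ) [W.IsElliptic] [W.IsGloballyMinimal] (N : ℕ) [NeZero N]
    (K : Type) [Field K] [NumberField K]
    (Dt : ModularParametrizationData W N) (H : HeegnerDatum N (NumberField.discr K)) (ι : K →+* ℂ)
    (P : (W.baseChange K).toAffine.Point),
    -- `W ≅_ℚ E_d : y² = x³ − 432 d`, of conductor `N`
    (∃ C : VariableChange ℚ, C • W = ({ a₁ := 0, a₂ := 0, a₃ := 0, a₄ := 0, a₆ := -432 * d } :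
      WeierstrassCurve ℚ)) →
    W.conductorNorm ℤ = N →
    -- `K` imaginary quadratic with the Heegner hypothesis for `3d`; `P = P_d` the Heegner point of `Dt`
    IsImaginaryQuadratic K → SatisfiesHeegnerHypothesis (3 * d.natAbs) K →
    WeierstrassCurve.Affine.Point.map ι.toRatAlgHom P = heegnerPointComplex Dt H →
    -- (1) `d` is a fundamental discriminant
    ((d % 4 = 1 ∧ Squarefree d ∧ d ≠ 1) ∨
      (4 ∣ d ∧ (d / 4 % 4 = 2 ∨ d / 4 % 4 = 3) ∧ Squarefree (d / 4))) →
    -- (2) `d ≡ 2, 3, 5, 8 (mod 9)`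
    (d % 9 = 2 ∨ d % 9 = 3 ∨ d % 9 = 5 ∨ d % 9 = 8) →
    -- (3) the `3`-class-number conditions
    (0 < d → ThreeClassNumberTrivial (-3 * d) ∧ ThreeClassNumberTrivial (NumberField.discr K * d)) →
    (d < 0 → ThreeClassNumberTrivial d ∧ ThreeClassNumberTrivial (-3 * NumberField.discr K * d)) →
    -- (4) the Manin constant of (this parametrisation of) `E_d` is prime to `3`
    ¬ (3 : ℤ) ∣ Dt.c →
    ¬ IsOfFinAddOrder P ∧ analyticRankEK W K = 1 ∧ (W.baseChange K).mordellWeilRank = 1 ∧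
      (Finite (W.baseChange K).sha →
        2 * padicValNat 3 W.tamagawaProduct + padicValNat 3 (W.baseChange K).shaOrder =
          2 * padicValNat 3 (AddSubgroup.zmultiples P).index)

/-- Bookkeeping form of the conclusion: under Theorem 10.10 and its hypotheses, and finiteness of
`Ш(E_d/K)`, the order `#Ш(E_d/K)` has EVEN `3`-adic valuation equal to
`2·(ord₃ [E_d(K):ℤP_d] − ord₃ ∏_ℓ c_ℓ(E_d))` — the square-root form
"`∏ c_ℓ · |Ш|^{1/2} = index/c`" of the printed display, read in `ℤ`. [cite: KrizLi2019, §10.3 display] -/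
theorem padicValNat_shaOrder_eq_of_thm1010 (h : thm1010_bsdThree_overK_sexticTwist)
    (d : ℤ) (W : WeierstrassCurve ℚ) [W.IsElliptic] [W.IsGloballyMinimal] (N : ℕ) [NeZero N]
    (K : Type) [Field K] [NumberField K]
    (Dt : ModularParametrizationData W N) (H : HeegnerDatum N (NumberField.discr K)) (ι : K →+* ℂ)
    (P : (W.baseChange K).toAffine.Point)
    (hW : ∃ C : VariableChange ℚ, C • W = ({ a₁ := 0, a₂ := 0, a₃ := 0, a₄ := 0, a₆ := -432 * d } :
      WeierstrassCurve ℚ))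
    (hN : W.conductorNorm ℤ = N) (hK : IsImaginaryQuadratic K)
    (hH : SatisfiesHeegnerHypothesis (3 * d.natAbs) K)
    (hP : WeierstrassCurve.Affine.Point.map ι.toRatAlgHom P = heegnerPointComplex Dt H)
    (h1 : (d % 4 = 1 ∧ Squarefree d ∧ d ≠ 1) ∨
      (4 ∣ d ∧ (d / 4 % 4 = 2 ∨ d / 4 % 4 = 3) ∧ Squarefree (d / 4)))
    (h2 : d % 9 = 2 ∨ d % 9 = 3 ∨ d % 9 = 5 ∨ d % 9 = 8)
    (h3pos : 0 < d → ThreeClassNumberTrivial (-3 * d) ∧ ThreeClassNumberTrivial (NumberField.discr K * d))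
    (h3neg : d < 0 → ThreeClassNumberTrivial d ∧ ThreeClassNumberTrivial (-3 * NumberField.discr K * d))
    (h4 : ¬ (3 : ℤ) ∣ Dt.c) (hfin : Finite (W.baseChange K).sha) :
    (padicValNat 3 (W.baseChange K).shaOrder : ℤ) =
      2 * ((padicValNat 3 (AddSubgroup.zmultiples P).index : ℤ) - padicValNat 3 W.tamagawaProduct) := by
  obtain ⟨-, -, -, hid⟩ := h d W N K Dt H ι P hW hN hK hH hP h1 h2 h3pos h3neg h4
  have := hid hfin
  omega

end Literature.NumberTheory.EllipticCurves.KrizLi2019
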